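import Literature.MathematicalPhysics.QuantumFieldTheory.Balaban1983to89.B1Eq324BenfattoAppendixA
import HarnessLib

/-!
# `Balaban1983to89.B1Eq324BenfattoKernelAppendixA` — [BenfattoEtAl1978] Appendix A (A.1)–(A.2) p. 161 FOR A GENERAL COVARIANCE KERNEL:
# the superstability lower bound `F_b ≥ exp(−|I|·k₁e^{−k₂b²})` for the Gaussian field of ANY positive-semidefinite kernel with bounded
# diagonal, with constants UNIFORM over the class `{K : K(x,x) ≤ g₀}`, PROVED

statement-level skeleton of published theorems with citation tags; proofs where landed; nothing here is a claim about the
Yang–Mills mass gap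

WHY THIS MODULE (cell `pub-ymgap`, seat `dag-n08-c` gen 22; node N08 [Balaban1985UV3]; the [BenfattoEtAl1978] source chain behind the
(α)-row `h324`).  The Lemma of Appendix A is the free-field input of the lower bound (4.7) of the Basic Lemma (p. 159 «b* can be chosen
= max{10⁴, γ⁻³b̄} where b̄ … defined in Appendix A»); the tree proves it for the free field (1.1): `…AppendixA.appendixA_explicit`
(`P0 d α β`, hypothesis `E z_Δ² = freeCov d α β 0 0 ≤ C`), consumed by the knit `…Sect5BasicLemmaKnit.appendixA_at_two`.  T. Bałaban applies
the METHOD of [BenfattoEtAl1978] to his own fluctuation covariances ([Balaban1982Higgs1] p. 616 *"all the assumptions are satisfied"*), i.e.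
to a CLASS of Gaussian lattice fields; the kernel census of the Basic Lemma (`pub-ymgap-dag-n08-c/N08-BASICLEMMA-KERNEL-CENSUS.md` §5, item
F6) records that Appendix A need NOT be a hypothesis of that class because `…AppendixA` §1 (`smallField_real_ge_of_sum_le`: Šidák's
inequality + one-site Chernoff tails) is already kernel-generic — an argument about a proof.  This file makes it a displayed theorem: (A.1)–(A.2)
for the Gaussian field `gaussianFieldOfKernel K` of every positive-semidefinite kernel `K` on `Q₀` whose diagonal is bounded, with the SAME
constants for the whole class (what an induction over renormalisation steps `k` needs: `b̄, k₁, k₂` must not depend on `k`).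

THE PRINTED STATEMENT (p. 160 last lines – p. 161; cf. the header of `…B1Eq324BenfattoAppendixA`): *"We define, for Δ ∈ Q₀, χ̂ᵇ_Δ =
χ(|z_Δ| ≦ b(1 + d(Δ, I)) ≡ b_Δ) and prove the following lemma: Lemma. Let P̂₀(dz) be defined as before. Then there exist b̄, k₁, k₂, such
that, for b > b̄,* `F_b ≡ ∫ P̂₀(dz) Π_{Δ∈Q₀} χ̂ᵇ_Δ ≧ exp[−|I|e_b]` *(A.1),* `e_b = k₁ exp(−k₂b²)` *(A.2)."*

WHAT IS PROVED (standard axioms; no `sorry`; no definition; `K : Q₀ → Q₀ → ℝ` positive semidefinite, `μ_K := gaussianFieldOfKernel K`,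
`Π_Δ χ̂ᵇ_Δ ↦ smallFieldSet I b`).
* ★★ `appendixA_explicit_of_kernel` — for `C > 0` with `K(x,x) ≤ C` for all `x`, every `b > 0` with `b² ≥ 4C` and every nonempty `I`:
  `exp(−|I|·(4·8^d)·e^{−b²/(2C)}) ≤ μ_K(smallFieldSet I b)`; the free-field `…AppendixA.appendixA_explicit` is its instance at `K = freeCov d α β`
  (`freeCov_self`) and is not restated.  Proof = the tree's, with the one free-field line replaced by the hypothesis: §1
  `smallField_real_ge_of_sum_le` and §2 `sum_exp_neg_threshold_sq_le` of `…AppendixA` BY NAME.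
* ★★ `appendixA_uniform_of_diag_le` — (A.1)–(A.2) with CLASS-UNIFORM constants: for every `g₀` there are
  `(b̄, k₁, k₂) = (max 2 (2(|g₀|+1)), 4·8^d, 1/(2(|g₀|+1)))`, `0 ≤ k₁`, `0 < k₂`, such that for EVERY positive-semidefinite `K` with `K(x,x) ≤ g₀`,
  every `b > b̄` and every nonempty `I`: `exp(−|I|·k₁e^{−k₂b²}) ≤ μ_K(smallFieldSet I b)` — the `(b̄, k₁, k₂)`-currency of the knit's socket
  (`…Sect5BasicLemmaKnit.basicLemma_signed_of_ledgers`, hypothesis `hboth`).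
* `appendixA_explicit_of_kernel_translate` — the bound, with the same constants, for every translate `K(· + s, · + s)` of such a `K` (a translate
  of a positive-semidefinite kernel is one — private `isPosSemidefKernel_translate` —, and the diagonal bound is shift-closed; the displaced
  pavements of §5 p. 159 cost nothing at the Appendix A input).

PROOF ROUTE ≠ PRINT'S (as in `…AppendixA`): Šidák's Gaussian correlation inequality and Chernoff one-site tails instead of Ruelle's superstability
estimate (A.3)–(A.6); only `K(x,x) ≤ C` is used.  HONEST SCOPE: count-neutral for N08; the class HYPOTHESES of a generalised Basic Lemma and that
lemma are NOT stated or proved here; nothing of [Balaban1985UV3] / [Balaban1985UV2] is asserted; nothing about d = 4, the continuum, OS axioms,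
a mass gap or the Clay problem.
-/

noncomputable section

open MeasureTheory ProbabilityTheory Finset
open scoped BigOperators

namespace Literature.MathematicalPhysics.QuantumFieldTheory.Balaban1983to89.B1Eq324BenfattoKernelAppendixA

open Literature.MathematicalPhysics.QuantumFieldTheory
open Literature.MathematicalPhysics.QuantumFieldTheory.Balaban1983to89.B1Eq324BenfattoLemma
open Literature.MathematicalPhysics.QuantumFieldTheory.Balaban1983to89.B1Eq324BenfattoAppendixA

variable {d : ℕ}

/-- The smallness regime: `2e^{−u} ≤ ½` for `u ≥ 2` (`e² ≥ 4`). [folklore] -/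
private theorem two_mul_exp_neg_le_half {u : ℝ} (hu : 2 ≤ u) : 2 * Real.exp (-u) ≤ 1 / 2 := by
  have h1 : (2 : ℝ) ≤ Real.exp 1 := by
    have := Real.add_one_le_exp (1 : ℝ)
    linarith
  have h4 : (4 : ℝ) ≤ Real.exp 2 := by
    have h2 : Real.exp 2 = Real.exp 1 * Real.exp 1 := by
      rw [← Real.exp_add]
      norm_num
    rw [h2]
    nlinarith [Real.exp_pos (1 : ℝ)]
  have hle : Real.exp (-u) ≤ Real.exp (-2) := Real.exp_le_exp.2 (by linarith)
  have hinv : Real.exp (-2) ≤ 1 / 4 := by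
    rw [Real.exp_neg, show (1 : ℝ) / 4 = (4 : ℝ)⁻¹ by norm_num]
    exact inv_anti₀ (by norm_num) h4
  linarith

/-- **(A.1)–(A.2) WITH EXPLICIT CONSTANTS FOR A GENERAL KERNEL.**  For a positive-semidefinite kernel `K` on `Q₀` whose one-site variances are
bounded, `K(x,x) ≤ C` (`C > 0`), every `b > 0` with `b² ≥ 4C` and every nonempty region `I ⊂ Q₀`:
`exp(−|I|·(4·8^d)·e^{−b²/(2C)}) ≤ F_b = μ_K(|z_Δ| ≤ b(1 + d(Δ, I)) ∀Δ ∈ Q₀)` — `k₁ = 4·8^d`, `k₂ = 1/(2C)` in (A.2), for the Gaussian field of `K`.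
The free-field theorem `…AppendixA.appendixA_explicit` is the instance `K = freeCov d α β` (`freeCov_self`).
[cite: BenfattoEtAl1978, Appendix A Lemma (A.1)–(A.2) p.161] -/
theorem appendixA_explicit_of_kernel {K : B1Eq324BenfattoLemma.Site d → B1Eq324BenfattoLemma.Site d → ℝ} (hK : IsPosSemidefKernel K)
    {C : ℝ} (hC : 0 < C) (hKC : ∀ x, K x x ≤ C) {b : ℝ} (hb0 : 0 < b) (hb : 4 * C ≤ b ^ 2)
    {I : Finset (B1Eq324BenfattoLemma.Site d)} (hI : I.Nonempty) :
    Real.exp (-((I.card : ℝ) * (4 * 8 ^ d * Real.exp (-(b ^ 2 / (2 * C)))))) ≤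
      (gaussianFieldOfKernel K).real (smallFieldSet I b) := by
  have h2C : 0 < 2 * C := by positivity
  have ht : ∀ x : B1Eq324BenfattoLemma.Site d, 0 < b * (1 + distToRegion I x) := fun x =>
    mul_pos hb0 (by linarith [distToRegion_nonneg I x])
  have hbt : ∀ x : B1Eq324BenfattoLemma.Site d, b ≤ b * (1 + distToRegion I x) := fun x => by
    have := distToRegion_nonneg I x
    nlinarith
  have hsmall : ∀ x : B1Eq324BenfattoLemma.Site d,
      2 * Real.exp (-((b * (1 + distToRegion I x)) ^ 2 / (2 * C))) ≤ 1 / 2 := by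
    intro x
    refine two_mul_exp_neg_le_half ?_
    have h1 : b ^ 2 ≤ (b * (1 + distToRegion I x)) ^ 2 := pow_le_pow_left₀ hb0.le (hbt x) 2
    have h2 : (2 : ℝ) ≤ b ^ 2 / (2 * C) := (le_div_iff₀ h2C).2 (by linarith)
    exact h2.trans (div_le_div_of_nonneg_right h1 h2C.le)
  have hT := fun F : Finset (B1Eq324BenfattoLemma.Site d) =>
    sum_exp_neg_threshold_sq_le hI F hC (by linarith : 2 * C ≤ b ^ 2)
  have key := smallField_real_ge_of_sum_le (ι := B1Eq324BenfattoLemma.Site d) hK (C := fun _ => C)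
    (t := fun x => b * (1 + distToRegion I x)) (fun _ => hC) hKC ht hsmall hT
  have hexp : (I.card : ℝ) * (4 * 8 ^ d * Real.exp (-(b ^ 2 / (2 * C)))) =
      4 * ((I.card : ℝ) * 8 ^ d * Real.exp (-(b ^ 2 / (2 * C)))) := by ring
  rw [hexp]
  exact key

/-- **(A.1)–(A.2) WITH CLASS-UNIFORM CONSTANTS.**  For every `g₀` the constants `b̄ = max 2 (2(|g₀| + 1))`, `k₁ = 4·8^d`, `k₂ = 1/(2(|g₀| + 1))`
(depending on `d` and `g₀` only) serve EVERY positive-semidefinite kernel `K` on `Q₀` with `K(x,x) ≤ g₀`: for `b > b̄` and every nonempty `I`,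
`exp(−|I|·k₁e^{−k₂b²}) ≤ μ_K(smallFieldSet I b)`.  This is the `(b̄, k₁, k₂)`-currency in which the knit of the Basic Lemma consumes Appendix A
(`…Sect5BasicLemmaKnit.basicLemma_signed_of_ledgers`); uniformity in `K` is what a renormalisation induction needs.
[cite: BenfattoEtAl1978, Appendix A Lemma (A.1)–(A.2) p.161] -/
theorem appendixA_uniform_of_diag_le (d : ℕ) (g₀ : ℝ) :
    ∃ bbar k₁ k₂ : ℝ, 0 ≤ k₁ ∧ 0 < k₂ ∧
      ∀ {K : B1Eq324BenfattoLemma.Site d → B1Eq324BenfattoLemma.Site d → ℝ}, IsPosSemidefKernel K → (∀ x, K x x ≤ g₀) →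
        ∀ b : ℝ, bbar < b → ∀ I : Finset (B1Eq324BenfattoLemma.Site d), I.Nonempty →
          Real.exp (-((I.card : ℝ) * (k₁ * Real.exp (-(k₂ * b ^ 2))))) ≤ (gaussianFieldOfKernel K).real (smallFieldSet I b) := by
  set C : ℝ := |g₀| + 1 with hC_def
  have hC : 0 < C := by positivity
  refine ⟨max 2 (2 * C), 4 * 8 ^ d, 1 / (2 * C), by positivity, by positivity, ?_⟩
  intro K hK hKg b hb I hI
  have hKC : ∀ x, K x x ≤ C := fun x => (hKg x).trans ((le_abs_self _).trans (by linarith))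
  have h2 : 2 < b := lt_of_le_of_lt (le_max_left _ _) hb
  have h2C : 2 * C < b := lt_of_le_of_lt (le_max_right _ _) hb
  have hb0 : 0 < b := by linarith
  have hb4 : 4 * C ≤ b ^ 2 := by nlinarith [mul_pos (sub_pos.2 h2C) hb0, mul_pos hC (sub_pos.2 h2)]
  have h := appendixA_explicit_of_kernel hK hC hKC hb0 hb4 hI
  have heq : 1 / (2 * C) * b ^ 2 = b ^ 2 / (2 * C) := by ring
  rw [heq]
  exact h

/-- kernel: a lattice translate `K(· + s, · + s)` of a positive-semidefinite kernel is positive semidefinite (its Gram matrices are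
re-indexed Gram matrices of `K`; the general re-indexing statement is `…CondKernelGeneric.isPosSemidefKernel_reindex`). [folklore] -/
private theorem isPosSemidefKernel_translate {K : B1Eq324BenfattoLemma.Site d → B1Eq324BenfattoLemma.Site d → ℝ}
    (hK : IsPosSemidefKernel K) (s : B1Eq324BenfattoLemma.Site d) :
    IsPosSemidefKernel fun x y => K (x + s) (y + s) := by
  intro I
  let f : I → (I.image fun x => x + s : Finset (B1Eq324BenfattoLemma.Site d)) :=
    fun i => ⟨(i : B1Eq324BenfattoLemma.Site d) + s, Finset.mem_image_of_mem (fun x => x + s) i.2⟩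
  have h : covGram (fun x y => K (x + s) (y + s)) I = (covGram K (I.image fun x => x + s)).submatrix f f := by
    ext i j
    rfl
  rw [h]
  exact (hK (I.image fun x => x + s)).submatrix f

/-- **The bound is the same for every lattice translate of the kernel** — if `K` is positive semidefinite with `K(x,x) ≤ C` for all `x`, then
every translate `K(· + s, · + s)` obeys (A.1)–(A.2) with the SAME constants (the diagonal bound is shift-closed): the displaced pavements of
§5 p. 159 cost nothing at the Appendix A input. [cite: BenfattoEtAl1978, Appendix A (A.1)–(A.2) p.161; §5 p.159] -/
theorem appendixA_explicit_of_kernel_translate {K : B1Eq324BenfattoLemma.Site d → B1Eq324BenfattoLemma.Site d → ℝ} (hK : IsPosSemidefKernel K)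
    {C : ℝ} (hC : 0 < C) (hKC : ∀ x, K x x ≤ C) {b : ℝ} (hb0 : 0 < b) (hb : 4 * C ≤ b ^ 2)
    {I : Finset (B1Eq324BenfattoLemma.Site d)} (hI : I.Nonempty) (s : B1Eq324BenfattoLemma.Site d) :
    Real.exp (-((I.card : ℝ) * (4 * 8 ^ d * Real.exp (-(b ^ 2 / (2 * C)))))) ≤
      (gaussianFieldOfKernel fun x y => K (x + s) (y + s)).real (smallFieldSet I b) :=
  appendixA_explicit_of_kernel (isPosSemidefKernel_translate hK s) hC (fun x => hKC (x + s)) hb0 hb hI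

end Literature.MathematicalPhysics.QuantumFieldTheory.Balaban1983to89.B1Eq324BenfattoKernelAppendixA

end
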